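import Literature.MathematicalPhysics.KineticTheory.LangevinChainLocalMinorization
import HarnessLib

/-!
# The pinned chain: the local minorisation at time one, UNIFORMLY for nearby bath temperatures

Helper file (`--supports`) for item stmt-AtomisticToContinuum-14071 (`CorrectorTheory`, route
`OddSectorIrreversibility`, sub-problem `FouriersLaw` of `AtomisticToContinuum`): the second input of the
uniform-in-`δ` Harris bound to which conjunct B of the item (and items 12696, 9144) are reduced in the
tree. `pinnedChain_minorization_at_one` (`LangevinChainLocalMinorization.lean`) gives, at FIXED bath
temperatures, `P_1(z, ·) ≥ c · Leb` on a ball, for `z` near the equilibrium. Here the same constants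
serve all bath temperatures whose noise amplitudes `√(2γT_b)` are close to reference ones: in the
finite-dimensional submersion argument the amplitudes enter only through a diagonal RESCALING of the
dyadic skeleton, `x ↦ (λ_L x¹, λ_R x²)` with `λ_b = √(2γT_b)/√(2γT_b⁰)`, which is put into the parameter
of the uniform submersion estimate `exists_measure_preimage_ge_of_surjective` together with the initial
condition and the remainder noise.

* `pinnedChain_minorization_at_one_uniform` — for reference temperatures `T_L⁰, T_R⁰ > 0` there are
  `ε₁, r > 0` and `c > 0` such that `P^{T_L,T_R}_1(z, T) ≥ c · Leb(T)` for all measurable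
  `T ⊆ B(0, r)`, all `‖z‖ < ε₁` and ALL bath temperatures with `|√(2γT_b)/√(2γT_b⁰) - 1| < ε₁`.

No definitions, no named facts.
-/

noncomputable section

open MeasureTheory ProbabilityTheory Filter Topology Set Metric Function unitInterval
open scoped NNReal ENNReal

namespace Summit.AtomisticToContinuum.FouriersLaw.Theorems.OddSectorIrreversibility.Corrector

open Literature.MathematicalPhysics.KineticTheory.HeatConduction
open Literature.Probability.Process Literature.Analysis.ODE Literature.Analysis.Calculus OscillatorChain
open Literature.MathematicalPhysics.KineticTheory

variable {N : ℕ}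

section One

variable {ω₂ lam β γ : ℝ} (hω : 0 < ω₂) (hl : 0 ≤ lam) (hβ : 0 < β) (hγ : 0 < γ)
  (hN : 0 < N) {TL₀ TR₀ : ℝ} (hL : 0 < TL₀) (hR : 0 < TR₀)
include hω hl hβ hγ hN hL hR

set_option maxHeartbeats 1600000 in
/-- **Local minorisation of the pinned chain at time one near the equilibrium, uniformly for nearby
bath temperatures.** For reference temperatures `T_L⁰, T_R⁰ > 0` there are `ε₁, r > 0` and `c > 0`
such that `P^{T_L,T_R}_1(z, T) ≥ c · Leb(T)` for every measurable `T ⊆ B(0, r)`, every initial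
condition `‖z‖ < ε₁` and every pair of bath temperatures whose noise amplitudes satisfy
`|√(2γT_L)/√(2γT_L⁰) - 1| < ε₁`, `|√(2γT_R)/√(2γT_R⁰) - 1| < ε₁`. Proof: the one of
`pinnedChain_minorization_at_one`, with the skeleton objects built at the reference amplitudes and the
skeleton rescaled by `diag(λ_L, λ_R)`; the scaling factors join `(z, ρ)` in the parameter of the
uniform submersion estimate. [cite: CuneoEckmannHairerReyBellet2018, Prop 3.6 (proof)] -/
theorem pinnedChain_minorization_at_one_uniform :
    ∃ ε₁ : ℝ, 0 < ε₁ ∧ ∃ r : ℝ, 0 < r ∧ ∃ c : ℝ≥0∞, 0 < c ∧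
      ∀ T_L T_R : ℝ, |Real.sqrt (2 * γ * T_L) / Real.sqrt (2 * γ * TL₀) - 1| < ε₁ →
        |Real.sqrt (2 * γ * T_R) / Real.sqrt (2 * γ * TR₀) - 1| < ε₁ →
      ∀ z : PhaseSpace N, ‖z‖ < ε₁ → ∀ T ⊆ ball (0 : PhaseSpace N) r, MeasurableSet T →
        c * volume T ≤ (pinnedChain ω₂ lam β γ).transitionKernel N T_L T_R 1 z T := by
  classical
  set cL : ℝ := Real.sqrt (2 * γ * TL₀) with hcL
  set cR : ℝ := Real.sqrt (2 * γ * TR₀) with hcR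
  have hcLpos : 0 < cL := Real.sqrt_pos.2 (by positivity)
  have hcRpos : 0 < cR := Real.sqrt_pos.2 (by positivity)
  have hcL0 : cL ≠ 0 := hcLpos.ne'
  have hcR0 : cR ≠ 0 := hcRpos.ne'
  -- the level `m` and the skeleton objects AT THE REFERENCE AMPLITUDES
  obtain ⟨m, hm⟩ := pinnedChain_exists_skeleton_level_surjective hω hl hβ.le hγ.le hN hcL0 cR
  let η : PairSkeleton m → C(I, Fin N → ℝ) → ℝ → Fin N → ℝ := fun x ρ t i =>
    ρ (projIcc 0 1 zero_le_one t) i +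
      ((if i.val = 0 then cL else 0) * plInterp m x.1 t.toNNReal +
        (if i.val = N - 1 then cR else 0) * plInterp m x.2 t.toNNReal)
  have hη : ∀ (x : PairSkeleton m) (ρ : C(I, Fin N → ℝ)) (t : ℝ) (i : Fin N),
      η x ρ t i = ρ (projIcc 0 1 zero_le_one t) i +
        ((if i.val = 0 then cL else 0) * plInterp m x.1 t.toNNReal +
          (if i.val = N - 1 then cR else 0) * plInterp m x.2 t.toNNReal) := fun _ _ _ _ => rfl
  obtain ⟨g, hg⟩ := exists_skelForcingCLM m cL cR η hη
  obtain ⟨S, hSapply, hS, huniq, hdiff⟩ := exists_skelSol hω hl hβ.le hγ.le m cL cR η hη g hg 1 le_rfl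
  have hS0 : S 0 = 0 := skelSol_zero hω hl hβ.le hγ.le m cL cR η hη hSapply
  have hsurjT := hm η hη g hg S hS huniq
  -- the rescaling of the skeleton
  let D : ℝ × ℝ → PairSkeleton m →L[ℝ] PairSkeleton m := fun l =>
    (l.1 • ContinuousLinearMap.id ℝ (Fin (2 ^ m) → ℝ)).prodMap (l.2 • ContinuousLinearMap.id ℝ (Fin (2 ^ m) → ℝ))
  have hDapply : ∀ (l : ℝ × ℝ) (x : PairSkeleton m), D l x = (l.1 • x.1, l.2 • x.2) := fun l x => rfl
  have hD1 : D (1, 1) = ContinuousLinearMap.id ℝ (PairSkeleton m) := by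
    ext x <;> simp [hDapply]
  have hD0 : ∀ l : ℝ × ℝ, D l 0 = 0 := fun l => map_zero _
  have hDc : Continuous fun l : ℝ × ℝ => D l :=
    (continuous_fst.smul continuous_const).prod_mapL ℝ (continuous_snd.smul continuous_const)
  -- the parameter space: `((z, ρ), (λ_L, λ_R))`
  let ι : PairSkeleton m →L[ℝ] PhaseSpace N × PairSkeleton m × C(I, Fin N → ℝ) :=
    (ContinuousLinearMap.inr ℝ (PhaseSpace N) (PairSkeleton m × C(I, Fin N → ℝ))).comp
      (ContinuousLinearMap.inl ℝ (PairSkeleton m) C(I, Fin N → ℝ))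
  have hι : ∀ x : PairSkeleton m, ι x = ((0 : PhaseSpace N), x, (0 : C(I, Fin N → ℝ))) := fun x => rfl
  let f : (PhaseSpace N × C(I, Fin N → ℝ)) × (ℝ × ℝ) → PairSkeleton m → PhaseSpace N :=
    fun p x => S (p.1.1, D p.2 x, p.1.2) 1
  let f' : (PhaseSpace N × C(I, Fin N → ℝ)) × (ℝ × ℝ) → PairSkeleton m → PairSkeleton m →L[ℝ] PhaseSpace N :=
    fun p x => (ContinuousMap.evalCLM ℝ (1 : I)).comp (((fderiv ℝ S (p.1.1, D p.2 x, p.1.2)).comp ι).comp (D p.2))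
  have hSd : Differentiable ℝ S := hdiff.differentiable one_ne_zero
  have hf' : ∀ p x, HasFDerivAt (f p) (f' p x) x := by
    intro p x
    have hA : HasFDerivAt (fun x : PairSkeleton m => (p.1.1, D p.2 x, p.1.2)) (ι.comp (D p.2)) x := by
      have h1 : (fun x : PairSkeleton m => (p.1.1, D p.2 x, p.1.2)) = fun x => (ι.comp (D p.2)) x + (p.1.1, 0, p.1.2) := by
        funext x; rw [ContinuousLinearMap.comp_apply, hι]; simp
      rw [h1]
      exact (ι.comp (D p.2)).hasFDerivAt.add_const _
    have hSx := (hSd (p.1.1, D p.2 x, p.1.2)).hasFDerivAt.comp x hA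
    have h := (ContinuousMap.evalCLM ℝ (1 : I)).hasFDerivAt.comp x hSx
    have e : (ContinuousMap.evalCLM ℝ (1 : I)).comp ((fderiv ℝ S (p.1.1, D p.2 x, p.1.2)).comp (ι.comp (D p.2))) =
        f' p x := by
      simp only [f', ContinuousLinearMap.comp_assoc]
    rw [e] at h
    exact h
  have hcontf' : Continuous fun q : ((PhaseSpace N × C(I, Fin N → ℝ)) × (ℝ × ℝ)) × PairSkeleton m => f' q.1 q.2 := by
    have hDx : Continuous fun q : ((PhaseSpace N × C(I, Fin N → ℝ)) × (ℝ × ℝ)) × PairSkeleton m => D q.1.2 q.2 := by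
      simp only [hDapply]; fun_prop
    have h1 : Continuous fun q : ((PhaseSpace N × C(I, Fin N → ℝ)) × (ℝ × ℝ)) × PairSkeleton m =>
        fderiv ℝ S (q.1.1.1, D q.1.2 q.2, q.1.1.2) :=
      (hdiff.continuous_fderiv one_ne_zero).comp (by fun_prop)
    have h2 : Continuous fun q : ((PhaseSpace N × C(I, Fin N → ℝ)) × (ℝ × ℝ)) × PairSkeleton m => D q.1.2 :=
      hDc.comp (continuous_snd.comp continuous_fst)
    exact continuous_const.clm_comp ((h1.clm_comp continuous_const).clm_comp h2)
  have hcontf : Continuous fun p : (PhaseSpace N × C(I, Fin N → ℝ)) × (ℝ × ℝ) => f p 0 := by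
    have h0 : (fun p : (PhaseSpace N × C(I, Fin N → ℝ)) × (ℝ × ℝ) => f p 0) = fun p => S (p.1.1, 0, p.1.2) 1 := by
      funext p; simp only [f, hD0]
    rw [h0]
    exact (ContinuousMap.evalCLM ℝ (1 : I)).continuous.comp (hdiff.continuous.comp (by fun_prop))
  set p₀ : (PhaseSpace N × C(I, Fin N → ℝ)) × (ℝ × ℝ) := ((0, 0), (1, 1)) with hp₀
  have hf00 : f p₀ 0 = 0 := by
    show S ((0 : PhaseSpace N), D (1, 1) (0 : PairSkeleton m), (0 : C(I, Fin N → ℝ))) 1 = 0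
    rw [hD0]
    have : ((0 : PhaseSpace N), (0 : PairSkeleton m), (0 : C(I, Fin N → ℝ))) = 0 := rfl
    rw [this, hS0]
    rfl
  have hsurj : LinearMap.range (f' p₀ 0 : PairSkeleton m →ₗ[ℝ] PhaseSpace N) = ⊤ := by
    have : ((0 : PhaseSpace N), (0 : PairSkeleton m), (0 : C(I, Fin N → ℝ))) = 0 := rfl
    show LinearMap.range (((ContinuousMap.evalCLM ℝ (1 : I)).comp (((fderiv ℝ S ((0 : PhaseSpace N),
      D (1, 1) (0 : PairSkeleton m), (0 : C(I, Fin N → ℝ)))).comp ι).comp (D (1, 1)))) :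
        PairSkeleton m →ₗ[ℝ] PhaseSpace N) = ⊤
    rw [hD0, hD1, ContinuousLinearMap.comp_id, this]
    exact hsurjT
  -- nontriviality of the skeleton space
  haveI : Nontrivial (PairSkeleton m) := by
    refine ⟨⟨0, (fun _ => 1, 0), fun h => ?_⟩⟩
    have := congrArg (fun q : PairSkeleton m => q.1 ⟨0, Nat.two_pow_pos m⟩) h
    simp at this
  -- Haar instances on the skeleton space and on phase space
  haveI hpiS : (volume : Measure (Fin (2 ^ m) → ℝ)).IsAddHaarMeasure := isAddHaarMeasure_volume_pi _
  haveI hpiP : (volume : Measure (Fin N → ℝ)).IsAddHaarMeasure := isAddHaarMeasure_volume_pi _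
  haveI hvolS : (volume : Measure (PairSkeleton m)).IsAddHaarMeasure :=
    Measure.prod.instIsAddHaarMeasure (volume : Measure (Fin (2 ^ m) → ℝ)) (volume : Measure (Fin (2 ^ m) → ℝ))
  haveI hvolP : (volume : Measure (PhaseSpace N)).IsAddHaarMeasure :=
    Measure.prod.instIsAddHaarMeasure (volume : Measure (Fin N → ℝ)) (volume : Measure (Fin N → ℝ))
  -- the submersion estimate, uniformly in `((z, ρ), (λ_L, λ_R))` near `((0, 0), (1, 1))`
  obtain ⟨V, hV, ρ₀, hρ₀, r, hr, c, hc, hmin⟩ :=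
    exists_measure_preimage_ge_of_surjective (volume : Measure (PairSkeleton m))
      (volume : Measure (PhaseSpace N)) f f' (Eventually.of_forall fun q => hf' q.1 q.2)
      hcontf'.continuousAt hcontf.continuousAt hsurj
  rw [hf00] at hmin
  obtain ⟨ε₀, hε₀, hε₀V⟩ := Metric.mem_nhds_iff.1 hV
  set ε₁ : ℝ := min ε₀ 1 with hε₁
  have hε₁ : 0 < ε₁ := lt_min hε₀ one_pos
  have hε₁0 : ε₁ ≤ ε₀ := min_le_left _ _
  have hε₁1 : ε₁ ≤ 1 := min_le_right _ _
  -- the law of the skeleton dominates Lebesgue measure on the ball of radius `ρ₀`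
  obtain ⟨c₂, hc₂, hskel⟩ := exists_wienerPair_map_pairSkel_ge m ρ₀
  -- the good remainders (amplitudes at most twice the reference ones)
  set cmax : ℝ := 2 * (|cL| + |cR|) with hcmax
  have hcmax0 : 0 ≤ cmax := by positivity
  have hCpos : 0 < (cmax + 1) * (1 + 2 * 2 ^ m) := by positivity
  set ε' : ℝ := ε₁ / 2 / ((cmax + 1) * (1 + 2 * 2 ^ m)) with hε'
  have hε'pos : 0 < ε' := by positivity
  have hε'bound : cmax * ((1 + 2 * 2 ^ m) * ε') < ε₁ := by
    have h1 : cmax * ((1 + 2 * 2 ^ m) * ε') ≤ (cmax + 1) * ((1 + 2 * 2 ^ m) * ε') :=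
      mul_le_mul_of_nonneg_right (by linarith) (by positivity)
    have h2 : (cmax + 1) * ((1 + 2 * 2 ^ m) * ε') = ε₁ / 2 := by
      rw [hε']; field_simp
    linarith
  -- the set of good remainder pairs (countably many conditions: measurable)
  set GoodR : Set WienerPair := {rr | (∀ n k : ℕ, ((k : ℝ≥0) / 2 ^ n ≤ 1) →
      |rr.1 ((k : ℝ≥0) / 2 ^ n)| ≤ (1 + 2 * 2 ^ m) * ε' ∧ |rr.2 ((k : ℝ≥0) / 2 ^ n)| ≤ (1 + 2 * 2 ^ m) * ε')}
    with hGoodR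
  have hGoodRm : MeasurableSet GoodR := by
    have : GoodR = ⋂ n : ℕ, ⋂ k : ℕ, {rr : WienerPair | ((k : ℝ≥0) / 2 ^ n ≤ 1) →
        |rr.1 ((k : ℝ≥0) / 2 ^ n)| ≤ (1 + 2 * 2 ^ m) * ε' ∧ |rr.2 ((k : ℝ≥0) / 2 ^ n)| ≤ (1 + 2 * 2 ^ m) * ε'} := by
      ext rr; simp [hGoodR]
    rw [this]
    refine MeasurableSet.iInter fun n => MeasurableSet.iInter fun k => ?_
    by_cases hkn : (k : ℝ≥0) / 2 ^ n ≤ 1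
    · simp only [hkn, forall_const]
      exact (measurableSet_le ((measurable_pi_apply _).comp measurable_fst).abs measurable_const).inter
        (measurableSet_le ((measurable_pi_apply _).comp measurable_snd).abs measurable_const)
    · simp [hkn]
  have hgood_sub : goodEvent ε' 1 ⊆ (pairRem m) ⁻¹' GoodR := by
    intro ω hω n k hk
    exact abs_pairRem_le_of_mem_goodEvent m hω hk
  have hgood_pos : 0 < wienerPair (goodEvent ε' 1) := wienerPair_goodEvent_pos hε'pos 1
  -- the constants
  refine ⟨ε₁, hε₁, r, hr, c₂ * c * wienerPair (goodEvent ε' 1),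
    ENNReal.mul_pos (ENNReal.mul_pos hc₂.ne' hc.ne').ne' hgood_pos.ne', fun T_L T_R hTL hTR z hz T hT hTm => ?_⟩
  -- the actual amplitudes and the scaling factors
  set aL : ℝ := Real.sqrt (2 * γ * T_L) with haL
  set aR : ℝ := Real.sqrt (2 * γ * T_R) with haR
  set lL : ℝ := aL / cL with hlL
  set lR : ℝ := aR / cR with hlR
  have hlL1 : |lL - 1| < ε₁ := hTL
  have hlR1 : |lR - 1| < ε₁ := hTR
  have haLe : aL = cL * lL := by rw [hlL]; field_simp
  have haRe : aR = cR * lR := by rw [hlR]; field_simp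
  have habsL : |aL| ≤ 2 * |cL| := by
    rw [haLe, abs_mul]
    have : |lL| ≤ 2 := by
      have h := abs_sub_abs_le_abs_sub lL 1
      rw [abs_one] at h
      linarith [hlL1, hε₁1]
    nlinarith [abs_nonneg cL]
  have habsR : |aR| ≤ 2 * |cR| := by
    rw [haRe, abs_mul]
    have : |lR| ≤ 2 := by
      have h := abs_sub_abs_le_abs_sub lR 1
      rw [abs_one] at h
      linarith [hlR1, hε₁1]
    nlinarith [abs_nonneg cR]
  have habs : |aL| + |aR| ≤ cmax := by rw [hcmax]; linarith
  -- the noise objects at the actual amplitudes, expressed through the reference ones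
  let ηa : PairSkeleton m → C(I, Fin N → ℝ) → ℝ → Fin N → ℝ := fun x ρ t i =>
    ρ (projIcc 0 1 zero_le_one t) i +
      ((if i.val = 0 then Real.sqrt (2 * γ * T_L) else 0) * plInterp m x.1 t.toNNReal +
        (if i.val = N - 1 then Real.sqrt (2 * γ * T_R) else 0) * plInterp m x.2 t.toNNReal)
  have hηa : ∀ (x : PairSkeleton m) (ρ : C(I, Fin N → ℝ)) (t : ℝ) (i : Fin N),
      ηa x ρ t i = ρ (projIcc 0 1 zero_le_one t) i +
        ((if i.val = 0 then Real.sqrt (2 * γ * T_L) else 0) * plInterp m x.1 t.toNNReal +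
          (if i.val = N - 1 then Real.sqrt (2 * γ * T_R) else 0) * plInterp m x.2 t.toNNReal) := fun _ _ _ _ => rfl
  have hηscale : ∀ (x : PairSkeleton m) (ρ : C(I, Fin N → ℝ)), η (D (lL, lR) x) ρ = ηa x ρ := by
    intro x ρ
    funext t i
    rw [hη, hηa, hDapply]
    simp only [plInterp_smul, ← haL, ← haR, haLe, haRe]
    split_ifs <;> ring
  let Sa : PhaseSpace N × PairSkeleton m × C(I, Fin N → ℝ) → C(I, PhaseSpace N) :=
    fun p => S (p.1, D (lL, lR) p.2.1, p.2.2)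
  have hSa : ∀ p τ, Sa p τ = (pinnedChain ω₂ lam β γ).chainFlow N p.1 (ηa p.2.1 p.2.2) τ := by
    intro p τ
    show S (p.1, D (lL, lR) p.2.1, p.2.2) τ = _
    rw [hSapply, hηscale]
  -- the transition probability as a Wiener integral, factorised through the skeleton
  have hkernel : (pinnedChain ω₂ lam β γ).transitionKernel N T_L T_R 1 z T =
      wienerPair ((fun ω => (pinnedChain ω₂ lam β γ).solMap N T_L T_R 1 z (pairPath ω)) ⁻¹' T) := by
    have h := pinnedChain_transitionKernel_apply' hω hl hβ.le hγ.le N T_L T_R 1 z hTm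
    simpa using h
  -- the integrand `G(x, rr) = 1_T(Φ_1(z, PL x + rr)) 1_{GoodR}(rr)`
  have h1m := pinnedChain_measurable_solMap hω hl hβ.le hγ.le N T_L T_R (1 : ℝ)
  have h2m : Measurable fun q : PairSkeleton m × WienerPair => ((z : PhaseSpace N), pairRecon m q.1 q.2) :=
    measurable_const.prodMk (measurable_pairRecon m)
  have hsolm : Measurable ((fun p : PhaseSpace N × WienerPair =>
      (pinnedChain ω₂ lam β γ).solMap N T_L T_R 1 p.1 p.2) ∘
      (fun q : PairSkeleton m × WienerPair => ((z : PhaseSpace N), pairRecon m q.1 q.2))) :=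
    Measurable.comp h1m h2m
  let G : PairSkeleton m × WienerPair → ℝ≥0∞ := fun q =>
    ((T.indicator (1 : PhaseSpace N → ℝ≥0∞)) ∘ ((fun p : PhaseSpace N × WienerPair =>
      (pinnedChain ω₂ lam β γ).solMap N T_L T_R 1 p.1 p.2) ∘
      (fun q : PairSkeleton m × WienerPair => ((z : PhaseSpace N), pairRecon m q.1 q.2)))) q *
      GoodR.indicator 1 q.2
  have hGm : Measurable G :=
    ((measurable_one.indicator hTm).comp hsolm).mul ((measurable_one.indicator hGoodRm).comp measurable_snd)
  -- `G(Ξ ω, R ω) ≤ 1_{Φ_1(z, B ω) ∈ T}`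
  have hGle : ∀ ω, G (pairSkel m ω, pairRem m ω) ≤
      ((fun ω => (pinnedChain ω₂ lam β γ).solMap N T_L T_R 1 z (pairPath ω)) ⁻¹' T).indicator 1 ω := by
    intro ω
    simp only [G, Function.comp_apply]
    rw [pairRecon_pairSkel_pairRem]
    by_cases hmem : (pinnedChain ω₂ lam β γ).solMap N T_L T_R 1 z (pairPath ω) ∈ T
    · rw [indicator_of_mem hmem, indicator_of_mem (show ω ∈ (fun ω => (pinnedChain ω₂ lam β γ).solMap N T_L T_R 1 z (pairPath ω)) ⁻¹' T
        from hmem)]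
      simp only [Pi.one_apply, one_mul]
      exact indicator_le_self' (fun _ _ => zero_le_one) _
    · rw [indicator_of_notMem hmem, zero_mul]
      exact zero_le
  -- for a good remainder of the Brownian pair, the inner integral is at least `c₂ c Leb(T)`
  have hinner : ∀ ω, pairRem m ω ∈ GoodR →
      c₂ * c * volume T ≤ ∫⁻ x, G (x, pairRem m ω) ∂(wienerPair.map (pairSkel m)) := by
    intro ω hωR
    set rr := pairRem m ω with hrr
    have hr1 : Continuous rr.1 := continuous_pairRem_fst m ω
    have hr2 : Continuous rr.2 := continuous_pairRem_snd m ω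
    obtain ⟨hr10, hr20⟩ := pairRem_apply_zero m ω
    -- the remainder noise path (at the actual amplitudes) and its smallness
    have hcI : Continuous fun τ : I => (⟨(τ : ℝ), τ.2.1⟩ : ℝ≥0) := continuous_subtype_val.subtype_mk _
    let ρr : C(I, Fin N → ℝ) := ⟨fun τ i => (if i.val = 0 then Real.sqrt (2 * γ * T_L) else 0) * rr.1 ⟨(τ : ℝ), τ.2.1⟩ +
        (if i.val = N - 1 then Real.sqrt (2 * γ * T_R) else 0) * rr.2 ⟨(τ : ℝ), τ.2.1⟩, by
      refine continuous_pi fun i => ?_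
      have h1 : Continuous fun τ : I => rr.1 ⟨(τ : ℝ), τ.2.1⟩ := hr1.comp hcI
      have h2 : Continuous fun τ : I => rr.2 ⟨(τ : ℝ), τ.2.1⟩ := hr2.comp hcI
      fun_prop⟩
    have hρr : ∀ (τ : I) (i : Fin N), ρr τ i = (if i.val = 0 then Real.sqrt (2 * γ * T_L) else 0) * rr.1 ⟨(τ : ℝ), τ.2.1⟩ +
        (if i.val = N - 1 then Real.sqrt (2 * γ * T_R) else 0) * rr.2 ⟨(τ : ℝ), τ.2.1⟩ := fun τ i => rfl
    have hsmall : ∀ u : ℝ≥0, u ≤ 1 → |rr.1 u| ≤ (1 + 2 * 2 ^ m) * ε' ∧ |rr.2 u| ≤ (1 + 2 * 2 ^ m) * ε' := by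
      intro u hu
      exact ⟨abs_le_of_dyadic hr1 (fun n k hk => (hωR n k hk).1) hu,
        abs_le_of_dyadic hr2 (fun n k hk => (hωR n k hk).2) hu⟩
    have hρnorm : ‖ρr‖ < ε₁ := by
      refine (ContinuousMap.norm_lt_iff _ hε₁).2 fun τ => ?_
      refine (pi_norm_le_iff_of_nonneg (by positivity)).2 (fun i => ?_) |>.trans_lt hε'bound
      rw [Real.norm_eq_abs, hρr]
      obtain ⟨h1, h2⟩ := hsmall ⟨(τ : ℝ), τ.2.1⟩ (by exact_mod_cast τ.2.2)
      have hL' : |(if i.val = 0 then Real.sqrt (2 * γ * T_L) else 0) * rr.1 ⟨(τ : ℝ), τ.2.1⟩| ≤ |aL| * ((1 + 2 * 2 ^ m) * ε') := by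
        rw [abs_mul]
        refine mul_le_mul ?_ h1 (abs_nonneg _) (abs_nonneg _)
        split_ifs <;> simp [haL]
      have hR' : |(if i.val = N - 1 then Real.sqrt (2 * γ * T_R) else 0) * rr.2 ⟨(τ : ℝ), τ.2.1⟩| ≤ |aR| * ((1 + 2 * 2 ^ m) * ε') := by
        rw [abs_mul]
        refine mul_le_mul ?_ h2 (abs_nonneg _) (abs_nonneg _)
        split_ifs <;> simp [haR]
      calc _ ≤ |(if i.val = 0 then Real.sqrt (2 * γ * T_L) else 0) * rr.1 ⟨(τ : ℝ), τ.2.1⟩| +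
            |(if i.val = N - 1 then Real.sqrt (2 * γ * T_R) else 0) * rr.2 ⟨(τ : ℝ), τ.2.1⟩| := abs_add_le _ _
        _ ≤ |aL| * ((1 + 2 * 2 ^ m) * ε') + |aR| * ((1 + 2 * 2 ^ m) * ε') := add_le_add hL' hR'
        _ = (|aL| + |aR|) * ((1 + 2 * 2 ^ m) * ε') := by ring
        _ ≤ cmax * ((1 + 2 * 2 ^ m) * ε') := mul_le_mul_of_nonneg_right habs (by positivity)
    -- `((z, ρr), (λ_L, λ_R)) ∈ V`
    have hzρ : (((z, ρr), (lL, lR)) : (PhaseSpace N × C(I, Fin N → ℝ)) × (ℝ × ℝ)) ∈ V := by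
      refine hε₀V ?_
      rw [mem_ball]
      change max (max (dist z 0) (dist ρr 0)) (max (dist lL 1) (dist lR 1)) < ε₀
      rw [dist_zero_right, dist_zero_right, Real.dist_eq, Real.dist_eq]
      exact max_lt (max_lt (hz.trans_le hε₁0) (hρnorm.trans_le hε₁0))
        (max_lt (hlL1.trans_le hε₁0) (hlR1.trans_le hε₁0))
    -- the inner integrand is the indicator of `{x | f ((z, ρr), (λ_L, λ_R)) x ∈ T}`
    have hGeq : ∀ x, G (x, rr) = ((f ((z, ρr), (lL, lR))) ⁻¹' T).indicator 1 x := by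
      intro x
      simp only [G, Function.comp_apply]
      rw [indicator_of_mem hωR, Pi.one_apply, mul_one,
        solMap_one_pairRecon_eq_skelSol hω hl hβ.le hγ.le T_L T_R m ηa hηa (S := Sa) hSa x hr1 hr2 hr10 hr20 ρr hρr z]
      rfl
    simp_rw [hGeq]
    have hfTm : MeasurableSet ((f ((z, ρr), (lL, lR))) ⁻¹' T) :=
      ((hf' ((z, ρr), (lL, lR)) ·) |> fun h => (continuous_iff_continuousAt.2 fun x => (h x).continuousAt)).measurable hTm
    rw [lintegral_indicator_one hfTm]
    calc c₂ * c * volume T = c₂ * (c * volume T) := mul_assoc _ _ _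
      _ ≤ c₂ * volume (closedBall (0 : PairSkeleton m) ρ₀ ∩ f ((z, ρr), (lL, lR)) ⁻¹' T) :=
          mul_le_mul' le_rfl (hmin _ hzρ T hT hTm)
      _ ≤ wienerPair.map (pairSkel m) (closedBall (0 : PairSkeleton m) ρ₀ ∩ f ((z, ρr), (lL, lR)) ⁻¹' T) :=
          hskel _ inter_subset_left (measurableSet_closedBall.inter hfTm)
      _ ≤ wienerPair.map (pairSkel m) (f ((z, ρr), (lL, lR)) ⁻¹' T) := measure_mono inter_subset_right
  -- assemble: Wiener integral ≥ factorised integral ≥ good part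
  rw [hkernel, ← lintegral_indicator_one ((hTm.preimage
    (pinnedChain_measurable_solMap_pairPath_right hω hl hβ.le hγ.le N T_L T_R 1 z)))]
  calc c₂ * c * wienerPair (goodEvent ε' 1) * volume T
      = c₂ * c * volume T * wienerPair (goodEvent ε' 1) := by ring
    _ ≤ c₂ * c * volume T * wienerPair ((pairRem m) ⁻¹' GoodR) := by
        gcongr
    _ = ∫⁻ ω, ((pairRem m) ⁻¹' GoodR).indicator (fun _ => c₂ * c * volume T) ω ∂wienerPair := by
        rw [lintegral_indicator_const (hGoodRm.preimage (measurable_pairRem m))]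
    _ ≤ ∫⁻ ω, ∫⁻ x, G (x, pairRem m ω) ∂(wienerPair.map (pairSkel m)) ∂wienerPair := by
        refine lintegral_mono fun ω => ?_
        by_cases hωR : pairRem m ω ∈ GoodR
        · rw [indicator_of_mem (show ω ∈ (pairRem m) ⁻¹' GoodR from hωR)]
          exact hinner ω hωR
        · rw [indicator_of_notMem (show ω ∉ (pairRem m) ⁻¹' GoodR from hωR)]
          exact zero_le
    _ = ∫⁻ ω, G (pairSkel m ω, pairRem m ω) ∂wienerPair := (lintegral_pairSkel_pairRem m hGm).symm
    _ ≤ ∫⁻ ω, ((fun ω => (pinnedChain ω₂ lam β γ).solMap N T_L T_R 1 z (pairPath ω)) ⁻¹' T).indicator 1 ω ∂wienerPair :=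
        lintegral_mono hGle

end One

end Summit.AtomisticToContinuum.FouriersLaw.Theorems.OddSectorIrreversibility.Corrector

end
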